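import Literature.AlgebraicGeometry.Motives.RatFnGenericFibreConstant
import Literature.AlgebraicGeometry.Motives.ShearCocycleUnitAtGenericFibre
import Literature.NumberTheory.EllipticCurves.NeronModelAbelianSchemeProofs
import Mathlib.AlgebraicGeometry.Morphisms.Proper
import HarnessLib

/-!
# The shear identity `Φ^*(pr₂^*θ) = pr₂^*θ` for the invariant top form, modulo the residue at `(ε,ε)` (road W, (W0) L4c′)

Topic `Literature/AlgebraicGeometry/Motives`, namespace `Literature.AlgebraicGeometry.Motives`.  THEOREMS ONLY.  Cell
`hodgecm-mathlib` (D-0151), fan B-III (T1) road W, sub-line `koizumi_strictly_local`, node (W0), leaf L4c′ (B-p18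
`W0CoreStubsV2` `stub_L4c'`; plan of record 2026-08-28T13:33:53Z / 14:00:09Z): the ASSEMBLY.  In the stub's context
(`𝒳 → Spec R` proper, `R` a dvr with fraction field `K`, `E` the group `K`-scheme with `e : 𝒳_K ≅ E`) the shear
cocycle `c = σ(pr₂♯ f₀) · B₂.det (d σ(pr₂♯ yᵢ))ᵢ · (pr₂♯ f₀)⁻¹ ∈ K(𝒳 ×_R 𝒳)` is

* a unit at every point of the generic fibre — B-p01's seam ★ `isUnitAt_shearCocycle_of_mem_genericFibre`;
* of residue `1` at the `K`-point `z = (ε,ε)` — hypothesis `hpin` here (B-p07's ★ `ResidueJacobianOne` /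
  `UnitSectionJacobian` and B-p01's ★ `exists_germs_cocycle_eq` produce it);

hence `c = 1` by constancy + evaluation on the proper generic fibre (★ `RatFn.eq_one_of_forall_isUnitAt_genericFibre_of_residue_eq_one`,
B-p12 p637743), i.e. `σ(pr₂♯ f₀) · B₂.det (d σ(pr₂♯ yᵢ))ᵢ = pr₂♯ f₀` — the conclusion of `stub_L4c'` VERBATIM
(`shear_identity_of_residue_eq_one`).  The `K`-point is `x := (η[E] ≫ e⁻¹) ≫ pr : Spec K → 𝒳` and
`z := (x, x) ∈ 𝒳 ×_R 𝒳` (`unitPoint_comp_hom`).  Banked leaf toward road W (r₀); no floor change.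

## References
* S. Bosch, W. Lütkebohmert, M. Raynaud, *Néron Models* (1990), §4.2 Prop. 1–2, §4.3 Prop. 2 (invariant differentials
  and birational group laws). [BLRNeronModels1990]
* B. Edixhoven, M. Romagny, *Group schemes out of birational group laws, Néron models* (2012), Thm. 6.3.
  [EdixhovenRomagny2012]
-/

noncomputable section

universe u

open CategoryTheory CategoryTheory.Limits AlgebraicGeometry MonoidalCategory CartesianMonoidalCategory
open Literature.NumberTheory.EllipticCurves Literature.AlgebraicGeometry.Motives
open Literature.AlgebraicGeometry.Motives.RatFn Literature.AlgebraicGeometry.Smoothening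
open scoped MonObj CategoryTheory.Obj

namespace Literature.AlgebraicGeometry.Motives

variable {R : Type u} [CommRing R] [IsDomain R] [IsDiscreteValuationRing R]
  {K : Type u} [Field K] [Algebra R K] [IsFractionRing R K]
  (𝒳 : Over (Spec (.of R))) [IsProper 𝒳.hom] [IsIntegral (𝒳 ⊗ 𝒳).left]
  (E : Over (Spec (.of K))) (e : (genericFibre R K).obj 𝒳 ≅ E)

omit [IsDomain R] [IsDiscreteValuationRing R] [IsIntegral (𝒳 ⊗ 𝒳).left] in
/-- `𝒳 ×_R 𝒳 → Spec R` is universally closed when `𝒳 → Spec R` is proper (base change and composition).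
[cite: BLRNeronModels1990, §4.3 (setting)] -/
theorem universallyClosed_tensorObj_hom : UniversallyClosed (𝒳 ⊗ 𝒳).hom := by
  rw [Over.tensorObj_hom]
  exact MorphismProperty.comp_mem _ _ _ (MorphismProperty.pullback_fst _ _ inferInstance) inferInstance

omit [IsDomain R] [IsDiscreteValuationRing R] [IsFractionRing R K] [IsProper 𝒳.hom] [IsIntegral (𝒳 ⊗ 𝒳).left] in
/-- The `K`-point `x = ε` of `𝒳` over the generic point, read from the unit of the group `K`-scheme `E` through
`e : 𝒳_K ≅ E`: `x ≫ (𝒳 → Spec R) = (Spec K → Spec R)`. [cite: BLRNeronModels1990, §4.2 (the unit section)] -/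
theorem unitPoint_comp_hom [MonObj E] :
    ((η[E].left ≫ e.inv.left) ≫ pullback.fst 𝒳.hom (specGenericPoint R K)) ≫ 𝒳.hom =
      specGenericPoint R K := by
  have hc : pullback.fst 𝒳.hom (specGenericPoint R K) ≫ 𝒳.hom =
      ((genericFibre R K).obj 𝒳).hom ≫ specGenericPoint R K := pullback.condition
  have h1 : (η[E].left ≫ e.inv.left) ≫ ((genericFibre R K).obj 𝒳).hom = 𝟙 _ := by
    rw [Category.assoc, Over.w e.inv]
    exact Over.w η[E]
  calc ((η[E].left ≫ e.inv.left) ≫ pullback.fst 𝒳.hom (specGenericPoint R K)) ≫ 𝒳.hom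
      = (η[E].left ≫ e.inv.left) ≫ (pullback.fst 𝒳.hom (specGenericPoint R K) ≫ 𝒳.hom) :=
        Category.assoc _ _ _
    _ = (η[E].left ≫ e.inv.left) ≫ (((genericFibre R K).obj 𝒳).hom ≫ specGenericPoint R K) := by
        erw [hc]; try rfl
    _ = ((η[E].left ≫ e.inv.left) ≫ ((genericFibre R K).obj 𝒳).hom) ≫ specGenericPoint R K := by
        simp only [Category.assoc]
    _ = specGenericPoint R K := by rw [h1]; exact Category.id_comp _

/-- **Constancy + evaluation for the shear cocycle**: a rational function `c` on `𝒳 ×_R 𝒳` which is a unit at every point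
of the generic fibre and whose germ at the `K`-point `z = (ε,ε)` has residue `1` is `1` (★ p637743 applied to
`𝒴 := 𝒳 ×_R 𝒳` with the section `(x, x)`). [cite: BLRNeronModels1990, §4.2 Prop. 2 (constancy step)] -/
theorem shearCocycle_eq_one_of_seam_of_pin [MonObj E] (c : (𝒳 ⊗ 𝒳).left.functionField)
    (hh : ∀ q : (𝒳 ⊗ 𝒳).left, (𝒳 ⊗ 𝒳).hom.base q ∈ Set.range (specGenericPoint R K).base → IsUnitAt q c)
    (hpin : ∃ t : (𝒳 ⊗ 𝒳).left.presheaf.stalk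
        ((pullback.lift ((η[E].left ≫ e.inv.left) ≫ pullback.fst 𝒳.hom (specGenericPoint R K))
          ((η[E].left ≫ e.inv.left) ≫ pullback.fst 𝒳.hom (specGenericPoint R K)) rfl :
            Spec (.of K) ⟶ (𝒳 ⊗ 𝒳).left).base (IsLocalRing.closedPoint K)),
        toFunctionField _ t = c ∧ IsLocalRing.residue _ t = 1) :
    c = 1 := by
  haveI := universallyClosed_tensorObj_hom 𝒳
  let x : Spec (.of K) ⟶ 𝒳.left := (η[E].left ≫ e.inv.left) ≫ pullback.fst 𝒳.hom (specGenericPoint R K)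
  have hx : x ≫ 𝒳.hom = specGenericPoint R K := unitPoint_comp_hom 𝒳 E e
  let s : Spec (.of K) ⟶ (𝒳 ⊗ 𝒳).left := pullback.lift x x rfl
  have h' : s ≫ (fst 𝒳 𝒳).left = x := pullback.lift_fst _ _ _
  have hs : s ≫ (𝒳 ⊗ 𝒳).hom = specGenericPoint R K := by
    rw [← Over.w (fst 𝒳 𝒳), ← Category.assoc, h']
    exact hx
  have hz : (𝒳 ⊗ 𝒳).hom.base (s.base (IsLocalRing.closedPoint K)) ∈ Set.range (specGenericPoint R K).base :=
    ⟨IsLocalRing.closedPoint K, by rw [← Scheme.Hom.comp_apply, hs]⟩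
  obtain ⟨t, ht, h1⟩ := hpin
  exact eq_one_of_forall_isUnitAt_genericFibre_of_residue_eq_one (𝒳 ⊗ 𝒳) s hs c hh hz ht h1

/-- **The shear identity `Φ^*(pr₂^*θ) = pr₂^*θ`, modulo the residue at `(ε,ε)`** — the conclusion of the (W0) core stub
`stub_L4c'` VERBATIM.  With the binders of B-p01's seam (`hRK`, `hLM` pin the two function-field algebra structures;
`D ⊇ U₀`, `ΦD` dominant over `pr₁` inducing isomorphisms of local rings along the generic fibre (`hisoSt`), `σ` its action
on `K(𝒳 ×_R 𝒳)`; the top form `θ = (f₀, y)` a frame along the generic fibre (`hθ`); `B₂ = d_{K(𝒳)}(pr₂♯ yᵢ)`), and the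
residue hypothesis `hpin` at the `K`-point `z = (ε, ε)` (`ε := η[E]` read through `e`), one has
`σ(pr₂♯ f₀) · B₂.det (d σ(pr₂♯ yᵢ))ᵢ = pr₂♯ f₀` in `K(𝒳 ×_R 𝒳)`: the cocycle is `1` by
`shearCocycle_eq_one_of_seam_of_pin`, and `pr₂♯ f₀ ≠ 0` because the cocycle is.
[cite: BLRNeronModels1990, §4.2 Prop. 2, §4.3 Prop. 2 (proof)] [cite: EdixhovenRomagny2012, Thm. 6.3 (proof)] -/
theorem shear_identity_of_residue_eq_one [MonObj E] [IsOpenImmersion (specGenericPoint R K)]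
    [IsIntegral 𝒳.left] [IsDominant (fst 𝒳 𝒳).left] [IsDominant (snd 𝒳 𝒳).left]
    (n : ℕ) [SmoothOfRelativeDimension n 𝒳.hom]
    [Algebra R 𝒳.left.functionField] [Algebra 𝒳.left.functionField (𝒳 ⊗ 𝒳).left.functionField]
    (hRK : algebraMap R 𝒳.left.functionField = stalkHom 𝒳 (genericPoint 𝒳.left))
    (hLM : algebraMap 𝒳.left.functionField (𝒳 ⊗ 𝒳).left.functionField =
      functionFieldMap (fst 𝒳 𝒳).left)
    (D : (𝒳 ⊗ 𝒳).left.Opens) [Nonempty D] [IsDominant D.ι]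
    (hD : (𝒳 ⊗ 𝒳).hom ⁻¹ᵁ (specGenericPoint R K).opensRange ≤ D)
    (ΦD : (D : Scheme.{u}) ⟶ (𝒳 ⊗ 𝒳).left) [IsDominant ΦD]
    (hΦ₁ : ΦD ≫ (fst 𝒳 𝒳).left = D.ι ≫ (fst 𝒳 𝒳).left)
    (hisoSt : ∀ qD : ↥(D : Scheme.{u}),
      (𝒳 ⊗ 𝒳).hom.base (D.ι.base qD) ∈ Set.range (specGenericPoint R K).base → IsIso (ΦD.stalkMap qD))
    (σ : (𝒳 ⊗ 𝒳).left.functionField →+* (𝒳 ⊗ 𝒳).left.functionField)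
    (hσ : (functionFieldMap D.ι).comp σ = functionFieldMap ΦD)
    (f₀ : 𝒳.left.functionField) (y : Fin n → 𝒳.left.functionField)
    (B₀ : Module.Basis (Fin n) 𝒳.left.functionField Ω[𝒳.left.functionField⁄R])
    (hB₀ : ∀ i, B₀ i = KaehlerDifferential.D R _ (y i))
    (hθ : ∀ (p : 𝒳.left) (_ : 𝒳.hom.base p ∈ Set.range (specGenericPoint R K).base)
        (z : Fin n → 𝒳.left.presheaf.stalk p)
        (b : letI := (stalkHom 𝒳 p).toAlgebra
          Module.Basis (Fin n) (𝒳.left.presheaf.stalk p) Ω[𝒳.left.presheaf.stalk p⁄R])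
        (_ : letI := (stalkHom 𝒳 p).toAlgebra; ∀ i, b i = KaehlerDifferential.D R _ (z i))
        (B : Module.Basis (Fin n) 𝒳.left.functionField Ω[𝒳.left.functionField⁄R])
        (_ : ∀ i, B i = KaehlerDifferential.D R _ (toFunctionField p (z i))),
        IsUnitAt p (f₀ * B.det B₀))
    (B₂ : Module.Basis (Fin n) (𝒳 ⊗ 𝒳).left.functionField
        Ω[(𝒳 ⊗ 𝒳).left.functionField⁄𝒳.left.functionField])
    (hB₂ : ∀ i, B₂ i = KaehlerDifferential.D 𝒳.left.functionField _
        (functionFieldMap (snd 𝒳 𝒳).left (y i)))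
    (hpin : ∃ t : (𝒳 ⊗ 𝒳).left.presheaf.stalk
        ((pullback.lift ((η[E].left ≫ e.inv.left) ≫ pullback.fst 𝒳.hom (specGenericPoint R K))
          ((η[E].left ≫ e.inv.left) ≫ pullback.fst 𝒳.hom (specGenericPoint R K)) rfl :
            Spec (.of K) ⟶ (𝒳 ⊗ 𝒳).left).base (IsLocalRing.closedPoint K)),
        toFunctionField _ t = σ (functionFieldMap (snd 𝒳 𝒳).left f₀) *
          B₂.det (fun i => KaehlerDifferential.D 𝒳.left.functionField _
            (σ (functionFieldMap (snd 𝒳 𝒳).left (y i)))) *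
          (functionFieldMap (snd 𝒳 𝒳).left f₀)⁻¹ ∧ IsLocalRing.residue _ t = 1) :
    σ (functionFieldMap (snd 𝒳 𝒳).left f₀) *
      B₂.det (fun i => KaehlerDifferential.D 𝒳.left.functionField _
        (σ (functionFieldMap (snd 𝒳 𝒳).left (y i)))) = functionFieldMap (snd 𝒳 𝒳).left f₀ := by
  classical
  have hh : ∀ q : (𝒳 ⊗ 𝒳).left, (𝒳 ⊗ 𝒳).hom.base q ∈ Set.range (specGenericPoint R K).base →
      IsUnitAt q (σ (functionFieldMap (snd 𝒳 𝒳).left f₀) *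
        B₂.det (fun i => KaehlerDifferential.D 𝒳.left.functionField _
          (σ (functionFieldMap (snd 𝒳 𝒳).left (y i)))) *
        (functionFieldMap (snd 𝒳 𝒳).left f₀)⁻¹) := fun q hq =>
    isUnitAt_shearCocycle_of_mem_genericFibre K 𝒳 n hRK hLM D hD ΦD hΦ₁ hisoSt σ hσ f₀ y B₀ hB₀ hθ B₂ hB₂ q hq
  have h1 := shearCocycle_eq_one_of_seam_of_pin 𝒳 E e _ hh hpin
  have hb : functionFieldMap (snd 𝒳 𝒳).left f₀ ≠ 0 := by
    intro hb
    rw [hb, inv_zero, mul_zero] at h1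
    exact zero_ne_one h1
  exact (mul_inv_eq_one₀ hb).mp h1

end Literature.AlgebraicGeometry.Motives

end
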